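import Summits.QuantumFields.BalabanUV.Beta.FP.TowerDoorGaugePeriodisedG
import Summits.QuantumFields.BalabanUV.Beta.FP.TowerDoorRecordDefsG
import Summits.QuantumFields.BalabanUV.Beta.FP.TowerDoorRecordGaugeLetter

/-!
# `BalabanUV.Beta.FP.TowerDoorRecordGaugeLetterRooted` — row D1 ∕ (C1) OWNER «beta-an2», PART 90 = PART 77′, ROUTE T (β1), v11 (R-root): **THE END's `hlv` LINE AS A THEOREM AT THE ROOTED
# ROWS — `hlv_rec_rooted`** = PART 77 `TowerDoorRecordGaugeLetter.hlv_rec` with v10's `hQ₁₀ ∕ hQ₂₀` replaced by an2 g81 W-8 R-1's ROOTED texts (`compRows Lc (fine Lc (Mc B)) (fun i => n+1−i)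
# (fun _ => ctrOff (3+1) Lc) (n+1)`; `bhKStepAt 3 (toSite (ctrOff (3+1) Lc)) Lc (n+1−0)` in the top step's slot rows), EVERY other binder CHARACTER FOR CHARACTER (`H₀ … hLN`, `XF hXF`, `h2` — under
# v11 fed by road `NestedKktEffNondegenerateRooted.h2_rec_rooted`), and the conclusion's gauge function the ROOTED record's: `lamRecG Lc (fun M _ ℓ _ => Qstep Lc M ℓ (ctrOff 4 Lc)) (sn n) n`
# (PART 87) — the road's debt R-2 twin typed by the road, the row's R-2 debt typed here (V11-DELTA cross-read W-8; FINDING AN2-82-1; road A-4 l.69064)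

WHAT ([folklore] BY NAME; no `def`, no `def … : Prop`, nothing cited, 0 sorry): §1 `lamRecG_eq_lamZG` (`rfl`, the consumer rewrites ONCE); §2 **`hlv_rec_rooted`** — PART 88
`lv_smul_single_eq_tsum_lamZG_at_pins_rooted` per `(n, B, μ, y, s)` with PART 77's instantiation map (`h1` from `hXF`, `hTW` by leaf-06 `torus_hTW_oneShot_tower` — the ROOTED G-2, no `c0`
to feed), `rw [lamRecG_eq_lamZG]; exact`.
WHAT THIS IS NOT: `h2` is NOT discharged here (displayed; the road's `h2_rec_rooted` discharges it from the same displays); NO display of v10∕v11 is discharged; the END is NOT instantiated; v11 NOT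
typed; nothing of Bałaban's asserted, valued or discharged; 0 estimates; 0∕4 row-D1 binders (hW, hR, D1Tel, D1Rep); ROOT M‴ p325680 ∕ P5c ∕ D6 untouched; NOT (C1), NOT (T-ID), NOT D1,
NEVER «G-an2-4 closed», NOT BetaPertH, NOT continuum, NOT Clay.


HONEST DEPENDENCY (page 1, mandatory): continuum YM on T⁴ ⇐ BetaPertH ∧ nine spine estimates (0/9 proved); BetaPertH ⇐ (D1) ∧ (D4) ∧ CAP+tail;
G-an2-4 gates asym, D1 and NE2/3/4.  HONEST FRAMING (cell contract, verbatim): «discharging `BetaPertH` makes Bałaban's UV stability UNCONDITIONAL —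
a real constructive-QFT result; it is NOT the continuum limit and NOT the Clay problem.»  ABSOLUTE RULE (cell charter, verbatim): «No internally-minted
statement may enter as a cited fact. Every hypothesis is either kernel-proved in this package or a verbatim quotation of a PUBLISHED theorem with page
reference. The manuscript(s) under audit are NOT citable for their own disputed steps — they are the thing under adjudication; programme-internal
(2001/route/tribunal) claims are never citable.»  Row D1 ∕ (C1) OWNER «beta-an2», b2b-balaban-beta-an2 gen 82, 2026-08-29.  No existing file touched.
-/

noncomputable section

open Finset Matrix Filter
open scoped BigOperators Matrix Topology
open Literature.Probability.LatticeModels (Torus.proj)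
open Literature.MathematicalPhysics.QuantumFieldTheory
open Literature.MathematicalPhysics.QuantumFieldTheory.Balaban1983to89
open Literature.MathematicalPhysics.QuantumFieldTheory.Balaban1983to89.Beta
open Literature.MathematicalPhysics.QuantumFieldTheory.Balaban1983to89.Beta.Composition (kkt)
open Literature.MathematicalPhysics.QuantumFieldTheory.Balaban1983to89.Beta.CompositionSingular (effForm minOp)
open B4TorusKernel.MultiPeriod (translate)
open B5Prop11Plancherel (fine)
open B6Lemma24Torus (pbox wrap)
open AffineAveraging (Site box toSite unitVec)
open AveragingContoursRooted (ctrOff ctrOff_mem_box)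
open OneStepResolventKernel (Fib)
open ExpKernelCalculus (MKer shiftK)
open HessKerRate (scaleK)
open Literature.MathematicalPhysics.QuantumFieldTheory.LatticeForm (quo)
open Summit.QuantumFields.BalabanUV.Beta.AxialDressingRooted (axEc)
open Summit.QuantumFields.BalabanUV.Beta.SymShiftedSpread (bhKStepSh)
open Summit.QuantumFields.BalabanUV.Beta.DshAn1 (Dsh)
open Summit.QuantumFields.BalabanUV.Beta.CompositeOneShotJetData (Roots AN)
open Summit.QuantumFields.BalabanUV.Beta.FP.KernelPeriodisationFib (Idx perF perZ)
open Summit.QuantumFields.BalabanUV.Beta.FP.TorusGaugeCovariancePairing (wrapPt wrapPt_coe)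
open Summit.QuantumFields.BalabanUV.Beta.FP.TorusGaugeCovarianceCoarse (coarsePt)
open Summit.QuantumFields.BalabanUV.Beta.FP.TorusCombRows (Res)
open Summit.QuantumFields.BalabanUV.Beta.FP.TorusCompositeObjects (towerTorus towerTorus_apply NParam combF bigP towerGen bigRoot bigRatio bigRatio_eq_pow towerEquiv Qstep compRows)
open Summit.QuantumFields.BalabanUV.Beta.FP.TorusCompositeObjectsG (StepRows)
open Summit.QuantumFields.BalabanUV.Beta.FP.TorusCompositeUnimodular (towerEvalC)
open Summit.QuantumFields.BalabanUV.Beta.GAN24.FineReadoutCauchyFrame (toSite_mem_range)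
open Summit.QuantumFields.BalabanUV.Beta.FP.NestedStepLawTorusInstance (coarseSlot_injective coarseSlot_range)
open Summit.QuantumFields.BalabanUV.Beta.FP.TorusCompositeSliceOneShot (torus_hTW_oneShot_tower)
open Summit.QuantumFields.BalabanUV.Beta.FP.TowerDoorGaugeRefDefsG (lamZG)
open Summit.QuantumFields.BalabanUV.Beta.FP.TowerDoorGaugePeriodisedG (lv_smul_single_eq_tsum_lamZG_at_pins_rooted)
open Summit.QuantumFields.BalabanUV.Beta.FP.TowerDoorRecordDefsG (lamRecG)
open Summit.QuantumFields.BalabanUV.Beta.BorderedHessian (bhKStepAt)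

namespace Summit.QuantumFields.BalabanUV.Beta.FP.TowerDoorRecordGaugeLetterRooted

variable (Lc : ℕ) [NeZero Lc]

/-! ## §1 The rooted record gauge function IS PART 81's lattice gauge function at v11's letters (`rfl`) -/

/-- [folklore] **`lamRecG_eq_lamZG`** — PART 87's `lamRecG Lc Q sn n` unfolds, by `rfl`, to PART 81's `lamZG Lc Q` at v10∕v11's levels `fun i => n+1−i`, the centred roots, their membership proof
and the `σₙ`-conjugated record chart.  Stated so that consumers rewrite ONCE. -/
theorem lamRecG_eq_lamZG (Q : StepRows 3 Lc) (sn : ℝ) (n : ℕ) :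
    lamRecG Lc Q sn n = lamZG Lc Q (fun i : ℕ => n + 1 - i) (fun _ : ℕ => ctrOff (3 + 1) Lc)
      (fun _ => toSite_mem_range (ctrOff_mem_box (d := 3 + 1) (Nat.one_le_iff_ne_zero.mpr (NeZero.ne Lc)))) n
      (scaleK (Sum.elim (fun _ : Fin (3 + 1) => (1 : ℝ)) (fun _ : Fin (3 + 1) => sn⁻¹)) (Sum.elim (fun _ : Fin (3 + 1) => (1 : ℝ)) (fun _ : Fin (3 + 1) => sn⁻¹))
        (AN (Roots.ctr Lc) (n + 1))) := rfl

/-! ## §2 The END's `hlv` line -/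

/-- [folklore] **`hlv_rec_rooted` — PART 74′'s letter `hlv` AT THE ROOTED ROWS, DERIVED**: under v11's binders (v10's with W-8 R-1's `hQ₁₀′ ∕ hQ₂₀′`) `H₀ … hLN`, `XF hXF` (twin 95207dc80dde0fe8 l.102–233, VERBATIM) and the skeleton's
non-degeneracy letter `h2` (road XREAD-1b, VERBATIM), for every `n B μ y s`:
`lv n B ((sn n·r n)•e_(wrapPt (Mc B) y, μ)) s = (sn n·r n) · Σ'_m lamRecG Lc (fun M _ ℓ _ => Qstep Lc M ℓ (ctrOff 4 Lc)) (sn n) n μ (translate (Mc B) ↑(wrapPt (Mc B) y) m) ↑s` — PART 88 per source, implicits passed explicitly, `rw [lamRecG_eq_lamZG]; exact`. -/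
theorem hlv_rec_rooted (Mc : ℕ → (Fin (3 + 1) → ℕ)) [∀ B μ, NeZero (Mc B μ)] (sn : ℕ → ℝ) (r : ∀ n : ℕ, ℝ)
    {H₀ : ∀ n : ℕ, ∀ B : ℕ, Matrix (↥(pbox (towerTorus Lc (fine Lc (Mc B)) (n + 1))) × Fin (3 + 1)) (↥(pbox (towerTorus Lc (fine Lc (Mc B)) (n + 1))) × Fin (3 + 1)) ℝ}
    {Q₁₀ : ∀ n : ℕ, ∀ B : ℕ, Matrix (↥(pbox (fine Lc (Mc B))) × Fin (3 + 1)) (↥(pbox (towerTorus Lc (fine Lc (Mc B)) (n + 1))) × Fin (3 + 1)) ℝ}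
    {τ₁ : ∀ n : ℕ, ∀ B : ℕ, Matrix (NParam Lc (fine Lc (fine Lc (Mc B))) (fun k => (fun _ : ℕ => ctrOff (3 + 1) Lc) (k + 1)) n) (↥(pbox (towerTorus Lc (fine Lc (Mc B)) (n + 1))) × Fin (3 + 1)) ℝ}
    (hH₀ : ∀ n : ℕ, ∀ B : ℕ, ((H₀ n) B) = (perF (towerTorus Lc (fine Lc (Mc B)) (n + 1)) (bhKStepSh 3 Lc (Dsh Lc) ((n + 1 - (n + 1))))).submatrix (fun b : (↥(pbox (towerTorus Lc (fine Lc (Mc B)) (n + 1))) × Fin (3 + 1)) => ((b.1, Sum.inl b.2) : Idx (towerTorus Lc (fine Lc (Mc B)) (n + 1)) (Fib 3))) (fun b : (↥(pbox (towerTorus Lc (fine Lc (Mc B)) (n + 1))) × Fin (3 + 1)) => ((b.1, Sum.inl b.2) : Idx (towerTorus Lc (fine Lc (Mc B)) (n + 1)) (Fib 3))))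
    (hQ₁₀ : ∀ n : ℕ, ∀ B : ℕ, ((Q₁₀ n) B) = compRows Lc (fine Lc (Mc B)) (fun i : ℕ => n + 1 - i) (fun _ : ℕ => ctrOff (3 + 1) Lc) (n + 1))
    (hτ₁ : ∀ n : ℕ, ∀ B : ℕ, ((τ₁ n) B) = bigP Lc (fine Lc (fine Lc (Mc B))) (fun k => (fun _ : ℕ => ctrOff (3 + 1) Lc) (k + 1)) (fun _ => toSite_mem_range (ctrOff_mem_box (d := 3 + 1) (Nat.one_le_iff_ne_zero.mpr (NeZero.ne Lc)))) n)
    {τ₂ : ∀ n : ℕ, ∀ B : ℕ, Matrix (Res (toSite (ctrOff (3 + 1) Lc)) Lc (fine Lc (Mc B))) (↥(pbox (fine Lc (Mc B))) × Fin (3 + 1)) ℝ}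
    (hτ₂ : ∀ n : ℕ, ∀ B : ℕ, ((τ₂ n) B) = combF Lc (fine Lc (Mc B)) ((fun _ : ℕ => ctrOff (3 + 1) Lc) 0))
    {Q₂₀ : ∀ n : ℕ, ∀ B : ℕ, Matrix ((↥(pbox (Mc B)) × Fin (3 + 1))) (↥(pbox (fine Lc (Mc B))) × Fin (3 + 1)) ℝ}
    (hQ₂₀ : ∀ n : ℕ, ∀ B : ℕ, ((Q₂₀ n) B) = (perF (fine Lc (Mc B)) (bhKStepAt 3 (toSite (ctrOff (3 + 1) Lc)) Lc ((n + 1 - 0)))).submatrix (fun a : ((↥(pbox (Mc B)) × Fin (3 + 1))) => ((coarsePt (Mc B) Lc a.1, Sum.inr (a.2)) : Idx (fine Lc (Mc B)) (Fib 3))) (fun b : ↥(pbox (fine Lc (Mc B))) × Fin (3 + 1) => ((b.1, Sum.inl b.2) : Idx (fine Lc (Mc B)) (Fib 3))))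
    {W₀ : ∀ n : ℕ, ∀ B : ℕ, Matrix (↥(pbox (towerTorus Lc (fine Lc (Mc B)) (n + 1))) × Fin (3 + 1)) (NParam Lc (fine Lc (Mc B)) (fun _ : ℕ => ctrOff (3 + 1) Lc) (n + 1)) ℝ}
    (hW₀ : ∀ n : ℕ, ∀ B : ℕ, ((W₀ n) B) = towerGen Lc (fine Lc (Mc B)) (fun _ : ℕ => ctrOff (3 + 1) Lc) (n + 1))
    {P : ∀ n : ℕ, ∀ B : ℕ, Matrix (NParam Lc (fine Lc (Mc B)) (fun _ : ℕ => ctrOff (3 + 1) Lc) (n + 1)) (↥(pbox (towerTorus Lc (fine Lc (Mc B)) (n + 1))) × Fin (3 + 1)) ℝ}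
    (hP : ∀ n : ℕ, ∀ B : ℕ, ((P n) B) = bigP Lc (fine Lc (Mc B)) (fun _ : ℕ => ctrOff (3 + 1) Lc) (fun _ => toSite_mem_range (ctrOff_mem_box (d := 3 + 1) (Nat.one_le_iff_ne_zero.mpr (NeZero.ne Lc)))) (n + 1))
    {I : ∀ n : ℕ, ∀ B : ℕ, Matrix (↥(pbox (towerTorus Lc (fine Lc (Mc B)) (n + 1))) × Fin (3 + 1)) ((↥(pbox (fine Lc (Mc B))) × Fin (3 + 1)) ⊕ (NParam Lc (fine Lc (fine Lc (Mc B))) (fun k => (fun _ : ℕ => ctrOff (3 + 1) Lc) (k + 1)) n)) ℝ}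
    {S : ∀ n : ℕ, ∀ B : ℕ, Matrix ((↥(pbox (fine Lc (Mc B))) × Fin (3 + 1)) ⊕ (NParam Lc (fine Lc (fine Lc (Mc B))) (fun k => (fun _ : ℕ => ctrOff (3 + 1) Lc) (k + 1)) n)) ((↥(pbox (fine Lc (Mc B))) × Fin (3 + 1)) ⊕ (NParam Lc (fine Lc (fine Lc (Mc B))) (fun k => (fun _ : ℕ => ctrOff (3 + 1) Lc) (k + 1)) n)) ℝ}
    (hI : ∀ n : ℕ, ∀ B : ℕ, minOp ((H₀ n) B) (fromRows ((Q₁₀ n) B) ((τ₁ n) B)) = ((I n) B))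
    (hS : ∀ n : ℕ, ∀ B : ℕ, effForm ((H₀ n) B) (fromRows ((Q₁₀ n) B) ((τ₁ n) B)) = ((S n) B))
    {𝔔₀ : ∀ n : ℕ, ∀ B : ℕ, Matrix ((↥(pbox (Mc B)) × Fin (3 + 1))) (↥(pbox (towerTorus Lc (fine Lc (Mc B)) (n + 1))) × Fin (3 + 1)) ℝ}
    (h𝔔₀ : ∀ n : ℕ, ∀ B : ℕ, ((Q₂₀ n) B) * ((Q₁₀ n) B) = ((𝔔₀ n) B))
    {hv : ∀ n : ℕ, ∀ B : ℕ, ((↥(pbox (Mc B)) × Fin (3 + 1)) → ℝ) → ((↥(pbox (towerTorus Lc (fine Lc (Mc B)) (n + 1))) × Fin (3 + 1)) → ℝ)}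
    (hhv : ∀ n : ℕ, ∀ B : ℕ, ∀ v, ((hv n) B) v = ((I n) B) *ᵥ Sum.elim (minOp ((S n) B).toBlocks₁₁ (fromRows ((Q₂₀ n) B) ((τ₂ n) B)) *ᵥ Sum.elim v 0) 0)
    (lv : ∀ n : ℕ, ∀ B : ℕ, ((↥(pbox (Mc B)) × Fin (3 + 1)) → ℝ) → (↥(pbox (towerTorus Lc (fine Lc (Mc B)) (n + 1))) → ℝ))
    (hlve : ∀ n : ℕ, ∀ B : ℕ, ∀ (v : ((↥(pbox (Mc B)) × Fin (3 + 1)) → ℝ)) (s : ↥(pbox (towerTorus Lc (fine Lc (Mc B)) (n + 1)))), ((lv n) B) v s = -(∑ x : Res (bigRoot Lc (fun _ : ℕ => ctrOff (3 + 1) Lc) (n + 1)) (bigRatio Lc (n + 1)) (towerTorus Lc (fine Lc (Mc B)) (n + 1)), (if (x.1 : ↥(pbox (towerTorus Lc (fine Lc (Mc B)) (n + 1)))) = s then (towerEvalC Lc (fine Lc (Mc B)) (fun _ : ℕ => ctrOff (3 + 1) Lc) (fun _ => toSite_mem_range (ctrOff_mem_box (d := 3 + 1) (Nat.one_le_iff_ne_zero.mpr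 (NeZero.ne Lc)))) (n + 1) *ᵥ ((((P n) B) * ((W₀ n) B))⁻¹ *ᵥ (((P n) B) *ᵥ ((hv n) B) v))) (towerEquiv Lc (fine Lc (Mc B)) (fun _ : ℕ => ctrOff (3 + 1) Lc) (fun _ => toSite_mem_range (ctrOff_mem_box (d := 3 + 1) (Nat.one_le_iff_ne_zero.mpr (NeZero.ne Lc)))) (n + 1) x) else 0)))
    {XN : ∀ n : ℕ, ∀ B : ℕ, Matrix ((↥(pbox (towerTorus Lc (fine Lc (Mc B)) (n + 1))) × Fin (3 + 1)) ⊕ ((↥(pbox (Mc B)) × Fin (3 + 1)) ⊕ (NParam Lc (fine Lc (Mc B)) (fun _ : ℕ => ctrOff (3 + 1) Lc) (n + 1)))) ((↥(pbox (towerTorus Lc (fine Lc (Mc B)) (n + 1))) × Fin (3 + 1)) ⊕ ((↥(pbox (Mc B)) × Fin (3 + 1)) ⊕ (NParam Lc (fine Lc (Mc B)) (fun _ : ℕ => ctrOff (3 + 1) Lc) (n + 1)))) ℝ}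
    (hXN : ∀ n : ℕ, ∀ B : ℕ, kkt ((H₀ n) B) (fromRows ((𝔔₀ n) B) ((P n) B)) * (XN n) B = 1)
    (ρN : ∀ n : ℕ, Fin (3 + 1) → ℤ)
    (fN : ∀ n : ℕ, ∀ B : ℕ, (↥(pbox (Mc B)) × Fin (3 + 1)) → Idx (towerTorus Lc (fine Lc (Mc B)) (n + 1)) (Fib 3))
    (hfN : ∀ n : ℕ, ∀ B : ℕ, ∀ a : ↥(pbox (Mc B)) × Fin (3 + 1), (fN n) B a = (wrapPt (towerTorus Lc (fine Lc (Mc B)) (n + 1)) (((Lc ^ (n + 1 + 1) : ℕ) : ℤ) • (a.1 : Site (3 + 1))), Sum.inr a.2))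
    (hEAN : ∀ n : ℕ, ∀ B : ℕ, perF (towerTorus Lc (fine Lc (Mc B)) (n + 1)) (axEc (ρN n) (Lc ^ (n + 1 + 1))) * perF (towerTorus Lc (fine Lc (Mc B)) (n + 1)) (scaleK (Sum.elim (fun _ : Fin (3 + 1) => (1 : ℝ)) (fun _ : Fin (3 + 1) => (sn n)⁻¹)) (Sum.elim (fun _ : Fin (3 + 1) => (1 : ℝ)) (fun _ : Fin (3 + 1) => (sn n)⁻¹)) (AN (Roots.ctr Lc) (n + 1))) = perF (towerTorus Lc (fine Lc (Mc B)) (n + 1)) (scaleK (Sum.elim (fun _ : Fin (3 + 1) => (1 : ℝ)) (fun _ : Fin (3 + 1) => (sn n)⁻¹)) (Sum.elim (fun _ : Fin (3 + 1) => (1 : ℝ)) (fun _ : Fin (3 + 1) => (sn n)⁻¹)) (AN (Roots.ctr Lc) (n + 1))))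
    (hLN : ∀ n : ℕ, ∀ B : ℕ, ((XN n) B).submatrix (Sum.map id Sum.inl) (Sum.map id Sum.inl) = fromBlocks (Matrix.of fun (b b' : (↥(pbox (towerTorus Lc (fine Lc (Mc B)) (n + 1))) × Fin (3 + 1))) => axEc (ρN n) (Lc ^ (n + 1 + 1)) (b.1 : Site (3 + 1)) (b.1 : Site (3 + 1)) (Sum.inl b.2) (Sum.inl b.2) * (axEc (ρN n) (Lc ^ (n + 1 + 1)) (b'.1 : Site (3 + 1)) (b'.1 : Site (3 + 1)) (Sum.inl b'.2) (Sum.inl b'.2) * perF (towerTorus Lc (fine Lc (Mc B)) (n + 1)) (scaleK (Sum.elim (fun _ : Fin (3 + 1) => (1 : ℝ)) (fun _ : Fin (3 + 1) => (sn n)⁻¹)) (Sum.elim (fun _ : Fin (3 + 1) => (1 : ℝ)) (fun _ : Fin (3 + 1) => (sn n)⁻¹)) (AN (Roots.ctr Lc) (n + 1))) (b.1, Sum.inl b.2) (b'.1, Sum.inl b'.2))) (Matrix.of fun (b : (↥(pbox (towerTorus Lc (fine Lc (Mc B)) (n + 1))) × Fin (3 + 1))) (a : (↥(pbox (Mc B))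 × Fin (3 + 1))) => axEc (ρN n) (Lc ^ (n + 1 + 1)) (b.1 : Site (3 + 1)) (b.1 : Site (3 + 1)) (Sum.inl b.2) (Sum.inl b.2) * perF (towerTorus Lc (fine Lc (Mc B)) (n + 1)) (scaleK (Sum.elim (fun _ : Fin (3 + 1) => (1 : ℝ)) (fun _ : Fin (3 + 1) => (sn n)⁻¹)) (Sum.elim (fun _ : Fin (3 + 1) => (1 : ℝ)) (fun _ : Fin (3 + 1) => (sn n)⁻¹)) (AN (Roots.ctr Lc) (n + 1))) (b.1, Sum.inl b.2) (((fN n) B) a)) (-Matrix.of fun (a : (↥(pbox (Mc B)) × Fin (3 + 1))) (b : (↥(pbox (towerTorus Lc (fine Lc (Mc B)) (n + 1))) × Fin (3 + 1))) => axEc (ρN n) (Lc ^ (n + 1 + 1)) (b.1 : Site (3 + 1)) (b.1 : Site (3 + 1)) (Sum.inl b.2) (Sum.inl b.2) * perF (towerTorus Lc (fine Lc (Mc B)) (n + 1)) (scaleK (Sum.elim (fun _ : Fin (3 + 1) => (1 : ℝ)) (fun _ : Fin (3 + 1) => (sn n)⁻¹)) (Sum.elim (fun _ : Fin (3 + 1)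 => (1 : ℝ)) (fun _ : Fin (3 + 1) => (sn n)⁻¹)) (AN (Roots.ctr Lc) (n + 1))) (((fN n) B) a) (b.1, Sum.inl b.2)) (-((perF (towerTorus Lc (fine Lc (Mc B)) (n + 1)) (scaleK (Sum.elim (fun _ : Fin (3 + 1) => (1 : ℝ)) (fun _ : Fin (3 + 1) => (sn n)⁻¹)) (Sum.elim (fun _ : Fin (3 + 1) => (1 : ℝ)) (fun _ : Fin (3 + 1) => (sn n)⁻¹)) (AN (Roots.ctr Lc) (n + 1)))).submatrix ((fN n) B) ((fN n) B))))
    {XF : ∀ n : ℕ, ∀ B : ℕ, Matrix ((↥(pbox (towerTorus Lc (fine Lc (Mc B)) (n + 1))) × Fin (3 + 1)) ⊕ ((↥(pbox (fine Lc (Mc B))) × Fin (3 + 1)) ⊕ (NParam Lc (fine Lc (fine Lc (Mc B))) (fun k => (fun _ : ℕ => ctrOff (3 + 1) Lc) (k + 1)) n))) ((↥(pbox (towerTorus Lc (fine Lc (Mc B)) (n + 1))) × Fin (3 + 1)) ⊕ ((↥(pbox (fine Lc (Mc B))) × Fin (3 + 1)) ⊕ (NParam Lc (fine Lc (fine Lc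 (Mc B))) (fun k => (fun _ : ℕ => ctrOff (3 + 1) Lc) (k + 1)) n))) ℝ}
    (hXF : ∀ n : ℕ, ∀ B : ℕ, kkt ((H₀ n) B) (fromRows ((Q₁₀ n) B) ((τ₁ n) B)) * (XF n) B = 1)
    (h2 : ∀ n : ℕ, ∀ B : ℕ, (kkt ((S n) B).toBlocks₁₁ (fromRows ((Q₂₀ n) B) ((τ₂ n) B))).det ≠ 0) :
    ∀ n : ℕ, ∀ B : ℕ, ∀ (μ : Fin (3 + 1)) (y : Site (3 + 1)) (s : ↥(pbox (towerTorus Lc (fine Lc (Mc B)) (n + 1)))),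
      ((lv n) B) (((sn n) * (r n)) • (Pi.single (wrapPt (Mc B) y, μ) (1 : ℝ) : ((↥(pbox (Mc B)) × Fin (3 + 1)) → ℝ))) s
        = ((sn n) * (r n)) * ∑' m : Site (3 + 1), lamRecG Lc (fun (M : Fin (3 + 1) → ℕ) (_ : ∀ μ, NeZero (M μ)) (ℓ : ℕ) (_ : Fin (3 + 1) → ℕ) => Qstep Lc M ℓ (ctrOff (3 + 1) Lc)) (sn n) n μ (translate (Mc B) ((wrapPt (Mc B) y : ↥(pbox (Mc B))) : Site (3 + 1)) m) (s : Site (3 + 1)) := by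
  intro n B μ y s
  have h57 := lv_smul_single_eq_tsum_lamZG_at_pins_rooted (R := Roots.ctr Lc) (M' := fine Lc (Mc B)) (Lc := Lc) (lev := fun i : ℕ => n + 1 - i) (n := n) (κ := ↥(pbox (Mc B)) × Fin (3 + 1))
    (H₀ := (H₀ n) B) (Q₁₀ := (Q₁₀ n) B) (τ₁ := (τ₁ n) B) (τ₂ := (τ₂ n) B) (Q₂₀ := (Q₂₀ n) B) (W₀ := (W₀ n) B) (P := (P n) B) (𝔔₀ := (𝔔₀ n) B) (I := (I n) B) (S := (S n) B) (hv := (hv n) B) (XN := (XN n) B)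
    (hrs := fun _ => ctrOff_mem_box (d := 3 + 1) (Nat.one_le_iff_ne_zero.mpr (NeZero.ne Lc)))
    (hlev := fun i hi => by show n + 1 - i = n + 1 - (i + 1) + 1; omega) (hM' := fun i => ⟨Mc B i, rfl⟩)
    (pμ' := fun a => coarsePt (Mc B) Lc a.1) (mμ' := fun a => a.2) (hfμ' := coarseSlot_injective (Mc B)) (hcoarse' := coarseSlot_range (Mc B))
    (hH₀ := hH₀ n B) (hQ₁₀ := hQ₁₀ n B) (hτ₁ := hτ₁ n B) (hτ₂ := hτ₂ n B) (hQ₂₀ := hQ₂₀ n B) (hW₀ := hW₀ n B) (hP := hP n B) (h𝔔₀ := h𝔔₀ n B) (hI := hI n B) (hS := hS n B)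
    (hhv := hhv n B) (hXN := hXN n B) (h1 := (Matrix.isUnit_det_of_right_inverse (hXF n B)).ne_zero) (h2 := h2 n B)
    (hTW := torus_hTW_oneShot_tower (fine Lc (Mc B)) Lc (fun i : ℕ => n + 1 - i) (fun _ : ℕ => ctrOff (3 + 1) Lc) n
      (fun _ => ctrOff_mem_box (d := 3 + 1) (Nat.one_le_iff_ne_zero.mpr (NeZero.ne Lc))) (fun i => ⟨Mc B i, rfl⟩)
      (hQ₁₀ n B) (hτ₁ n B) (hτ₂ n B) (hW₀ n B)) (Mc := Mc B) (hMc := fun i => rfl)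
    (σ := Sum.elim (fun _ : Fin (3 + 1) => (1 : ℝ)) (fun _ : Fin (3 + 1) => (sn n)⁻¹)) (ρN := ρN n) (LNc := Lc ^ (n + 1 + 1)) (fN := (fN n) B) (hEAN := hEAN n B) (hLN := hLN n B)
    (a := (wrapPt (Mc B) y, μ)) (w := ((wrapPt (Mc B) y : ↥(pbox (Mc B))) : Site (3 + 1))) (μ := μ) (hfa := hfN n B (wrapPt (Mc B) y, μ)) (c := (sn n) * (r n))
    (lv := (lv n) B) (hlve := hlve n B) (s := s)
  rw [lamRecG_eq_lamZG]
  exact h57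

end Summit.QuantumFields.BalabanUV.Beta.FP.TowerDoorRecordGaugeLetterRooted

end
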